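import Literature.AnabelianGeometry.SemiGraphs.BoundedDegreeCoveringsFinite
import Literature.AnabelianGeometry.SemiGraphs.ChartFibreProfiniteCompletionIndexFinite
import HarnessLib

/-!
# The characteristic open levels of `π₁^temp(𝒢)` for a FINITE coherent semi-graph of anabelioids —
# [SemiAnbd] Prop 5.2 (i) / Ex 3.10, binder-free (row T54·E1b, end-to-end)

Mochizuki, *Semi-graphs of anabelioids*, Publ. RIMS **42** (2006): Ex. 3.10 p. 44 ("an exhaustive sequence of
open characteristic subgroups of finite index"), Prop. 5.2 (i) p. 63 / proof p. 64 ("follow from the various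
finiteness assumptions … the fact that `G` is coherent"). [cite: MochizukiSemiAnbd2006, Prop 5.2 (i), p. 63]

abc-iut cell, layer L3, row **T54·E1b** (`HOME/plan/GAP-LEDGER.md` G-w4d053-1; seat abc-iut-w4-d048 gen 3),
END-TO-END: abc-iut-w6-d064's transport `charOpenCore_family_chart_of_prop36 (hAut)` /
`finite_openSubgroupsIndexLE_chart_of_autFiberAt_of_prop36 (hAut)` (`ChartFibreProfiniteCompletionIndexFinite.lean`:
from the profinite completion `π̂₁(𝒢) = Aut(𝒢.fiberAt v)` to the chart group `c.G = π₁^temp(𝒢)`) fed with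
the finiteness theorem `openSubgroupsIndexLE_autFiberAt_finite` (`BoundedDegreeCoveringsFinite.lean`), so that
NO `hAut` binder remains: for a FINITE semi-graph of anabelioids satisfying `Prop36Hypotheses` whose vertex
and edge groups have finitely many open subgroups of each bounded index (e.g. are topologically finitely
generated — coherence, [SemiAnbd] Def. 2.3 (iii)),

* `finite_openSubgroupsIndexLE_chart_of_constituents` — `π₁^temp(𝒢)` has finitely many open subgroups of
  index `≤ d` (the capstone's `hfin` at `c.G`);
* `charOpenCore_family_chart_of_tfg_constituents` — abc-iut-w4-d053's characteristic open cores
  `charOpenCore c.G n` are an antitone family of OPEN NORMAL FINITE-INDEX subgroups of `π₁^temp(𝒢)`, fixed by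
  every bi-continuous automorphism and cofinal among the open finite-index subgroups — the level shape consumed
  by abc-iut-L3-t9's `GaloisLevelData.ofGaloisSeq` and the T54-B capstone binders `hKst` / `hLst`
  (`charOpenCore_stable_outerSemidirectProduct`).

Neither topological finite generation of `π₁^temp(𝒢)` nor of `π̂₁(𝒢)` is used or claimed (abc-iut-w4-d071's
`GaloisLevelData.isTopologicallyFinitelyGenerated_temperedPi` is the independent stronger route).  Proof-only;
nothing here takes a side on [IUTchIII] Cor. 3.12.
-/

namespace Literature.AnabelianGeometry.SemiGraphs

namespace ProfiniteSemiGraph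

open Literature.AnabelianGeometry.AbsoluteAnabelian (IsTopologicallyFinitelyGenerated)

universe u

variable {𝒢 : ProfiniteSemiGraph.{u}}

/-- **Bounded form at `π₁^temp(𝒢)`**: for a finite semi-graph of anabelioids satisfying `Prop36Hypotheses`,
if every vertex and edge group has finitely many open subgroups of index `≤ d`, then the chart group
`c.G = π₁^temp(𝒢)` has finitely many open subgroups of index `≤ d`.
[cite: MochizukiSemiAnbd2006, Prop 5.2 (i), p. 63] -/
theorem finite_openSubgroupsIndexLE_chart_of_constituents [Finite 𝒢.graph.Vertex] [Finite 𝒢.graph.Branch]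
    (h36 : 𝒢.Prop36Hypotheses) (c : TemperedPiChart 𝒢) (v : 𝒢.graph.Vertex) {d : ℕ}
    (hV : ∀ w : 𝒢.graph.Vertex, (openSubgroupsIndexLE (𝒢.Gv w) d).Finite)
    (hE : ∀ e : 𝒢.graph.Edge, (openSubgroupsIndexLE (𝒢.Ge e) d).Finite) :
    (openSubgroupsIndexLE c.G d).Finite :=
  finite_openSubgroupsIndexLE_chart_of_autFiberAt_of_prop36 h36 c v
    (openSubgroupsIndexLE_autFiberAt_finite 𝒢 hV hE h36.isConnected v)

/-- **T54·E1b end-to-end — the characteristic open levels of `π₁^temp(𝒢)`**: for a FINITE semi-graph of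
anabelioids satisfying `Prop36Hypotheses` whose vertex and edge groups are topologically finitely generated,
`n ↦ charOpenCore c.G n` is an antitone family of OPEN NORMAL FINITE-INDEX subgroups of `c.G = π₁^temp(𝒢)`,
each fixed by every bi-continuous automorphism, and every open finite-index subgroup contains one of them
(abc-iut-w6-d064's `charOpenCore_family_chart_of_prop36` with its `hAut` discharged by
`openSubgroupsIndexLE_autFiberAt_finite_of_tfg`). [cite: MochizukiSemiAnbd2006, Prop 5.2 (i), p. 63] -/
theorem charOpenCore_family_chart_of_tfg_constituents [Finite 𝒢.graph.Vertex] [Finite 𝒢.graph.Branch]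
    (h36 : 𝒢.Prop36Hypotheses) (c : TemperedPiChart 𝒢) (v : 𝒢.graph.Vertex)
    (hVt : ∀ w : 𝒢.graph.Vertex, IsTopologicallyFinitelyGenerated (𝒢.Gv w))
    (hEt : ∀ e : 𝒢.graph.Edge, IsTopologicallyFinitelyGenerated (𝒢.Ge e)) :
    Antitone (charOpenCore c.G) ∧
      (∀ n, IsOpen (charOpenCore c.G n : Set c.G) ∧ (charOpenCore c.G n).Normal ∧
        (charOpenCore c.G n).FiniteIndex ∧
        ∀ φ : MulAut c.G, Continuous φ → Continuous φ.symm →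
          (charOpenCore c.G n).map φ.toMonoidHom = charOpenCore c.G n) ∧
      ∀ U : Subgroup c.G, IsOpen (U : Set c.G) → U.FiniteIndex → ∃ n, charOpenCore c.G n ≤ U :=
  charOpenCore_family_chart_of_prop36 h36 c v fun n =>
    openSubgroupsIndexLE_autFiberAt_finite_of_tfg 𝒢 h36.isConnected v hVt hEt n

/-- In particular each characteristic open core of `π₁^temp(𝒢)` is OPEN and of FINITE INDEX (the two facts the
T54-B tower construction uses at a prescribed level `n`). [cite: MochizukiSemiAnbd2006, Prop 5.2 (i), p. 63] -/
theorem isOpen_finiteIndex_charOpenCore_chart [Finite 𝒢.graph.Vertex] [Finite 𝒢.graph.Branch]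
    (h36 : 𝒢.Prop36Hypotheses) (c : TemperedPiChart 𝒢) (v : 𝒢.graph.Vertex)
    (hVt : ∀ w : 𝒢.graph.Vertex, IsTopologicallyFinitelyGenerated (𝒢.Gv w))
    (hEt : ∀ e : 𝒢.graph.Edge, IsTopologicallyFinitelyGenerated (𝒢.Ge e)) (n : ℕ) :
    IsOpen (charOpenCore c.G n : Set c.G) ∧ (charOpenCore c.G n).FiniteIndex :=
  let h := (charOpenCore_family_chart_of_tfg_constituents h36 c v hVt hEt).2.1 n
  ⟨h.1, h.2.2.1⟩

end ProfiniteSemiGraph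

end Literature.AnabelianGeometry.SemiGraphs
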